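import Summits.Ventures.PercRepro.Night2FatYGood
import Summits.Ventures.PercRepro.Night2FatXTwoPlanes

/-!
# night-2: the geometry of the two-planes regime of the fat case

When some lossy big pair of `G` has NO good point (the complement of `hgood`, `Night2FatYGood`), `H₀ = clF B₀ ∖ K` is
the union of two planes through a line `R₁` coplanar with the two off-points (`two_planes_of_no_gtPts`,
`rkN_line_off_le_three_of_no_gtPts`).  This module records the geometric consequences used by the counting of that
regime, with the two planes `clF (insert c₂ R₁)`, `clF (insert c₃ R₁)` abstract:

* **`subset_plane_of_rkN_le_two_of_cover`**: every rank-`2` set of `≥ 3` points covered by the two planes lies in one of them;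
* **`mem_clF_of_mem_two_planes`**: the two planes meet in the line `clF R₁`;
* **`card_le_two_of_rkN_le_two_of_cross`**: a line through a point of `π₂ ∖ R₁` and a point of `π₃ ∖ R₁` has no third point;
* **`rkN_union_le_two_of_coplanar_off`**: two lines of `clF B₀` through a common point `a` with `rk {a, w₀, x} = 3`, both
  coplanar with `w₀, x`, span a line — the class line through a point off the pencil point is unique;
* **`not_coplanar_off_of_coplanar_off`**: two basis lines `ℓ_ab`, `ℓ_ac` through a point `a` with `rk {a, w₀, x} = 3`
  are not both coplanar with `w₀, x`;
* **`exists_two_planes_of_not_good`**: the regime itself — a lossy big pair without good points yields `R₁`, `c₂`, `c₃`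
  with these properties.
Paper `proofs/NIGHT-2-g34.md` §2.
-/

namespace PercRepro.Shadow

open PercRepro.ThmH PercRepro.PerFlat

variable {α : Type*} [DecidableEq α] {M : Matroid α} [M.Finite] {G : Finset α}

/-- **A rank-`2` set of `≥ 3` points covered by two closures lies in one of them.** -/
theorem subset_plane_of_rkN_le_two_of_cover (hs : ∀ e ∈ gr M, ∀ f ∈ gr M, e ≠ f → rkN M {e, f} = 2)
    {S : Finset α} (hSg : S ⊆ gr M) (hS2 : rkN M S ≤ 2) (hS3 : 3 ≤ S.card) {X Y : Finset α}
    (hcover : ∀ e ∈ S, e ∈ clF M X ∨ e ∈ clF M Y) : S ⊆ clF M X ∨ S ⊆ clF M Y := by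
  obtain ⟨a, ha, b, hb, c, hc, hab, hac, hbc⟩ := Finset.two_lt_card.1 hS3
  have key : ∀ u ∈ S, ∀ v ∈ S, u ≠ v → ∀ Z : Finset α, u ∈ clF M Z → v ∈ clF M Z → S ⊆ clF M Z :=
    fun u hu v hv huv Z huZ hvZ => subset_clF_of_rkN_le_two_of_two_mem hs hSg hS2 hu hv huv huZ hvZ
  rcases hcover a ha with ha2 | ha3 <;> rcases hcover b hb with hb2 | hb3 <;> rcases hcover c hc with hc2 | hc3
  · exact Or.inl (key a ha b hb hab _ ha2 hb2)
  · exact Or.inl (key a ha b hb hab _ ha2 hb2)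
  · exact Or.inl (key a ha c hc hac _ ha2 hc2)
  · exact Or.inr (key b hb c hc hbc _ hb3 hc3)
  · exact Or.inl (key b hb c hc hbc _ hb2 hc2)
  · exact Or.inr (key a ha c hc hac _ ha3 hc3)
  · exact Or.inr (key a ha b hb hab _ ha3 hb3)
  · exact Or.inr (key a ha b hb hab _ ha3 hb3)

/-- **The two planes through a line meet in that line.** -/
theorem mem_clF_of_mem_two_planes {R₁ : Finset α} (hR₁g : R₁ ⊆ gr M) {c₂ c₃ : α} (hc₂g : c₂ ∈ gr M)
    (hc₃g : c₃ ∈ gr M) (hc₂ : c₂ ∉ clF M R₁) (hc₃ : c₃ ∉ clF M (insert c₂ R₁)) {e : α}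
    (h2 : e ∈ clF M (insert c₂ R₁)) (h3 : e ∈ clF M (insert c₃ R₁)) : e ∈ clF M R₁ := by
  have hXg : insert c₂ R₁ ⊆ gr M := Finset.insert_subset hc₂g hR₁g
  have hYg : insert c₃ R₁ ⊆ gr M := Finset.insert_subset hc₃g hR₁g
  have hc₃' : c₃ ∉ clF M R₁ := fun h' => hc₃ (clF_mono (Finset.subset_insert _ _) h')
  have hX : rkN M (insert c₂ R₁) = rkN M R₁ + 1 := rkN_insert_of_notMem_clF hc₂g hc₂
  have hY : rkN M (insert c₃ R₁) = rkN M R₁ + 1 := rkN_insert_of_notMem_clF hc₃g hc₃'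
  have hU : insert c₂ R₁ ∪ insert c₃ R₁ = insert c₃ (insert c₂ R₁) := by
    ext u
    simp only [Finset.mem_union, Finset.mem_insert]
    tauto
  have hXY : rkN M (insert c₂ R₁ ∪ insert c₃ R₁) = rkN M R₁ + 2 := by
    rw [hU, rkN_insert_of_notMem_clF hc₃g hc₃, hX]
  exact mem_clF_of_mem_clF_of_mem_clF hXg hYg (Finset.subset_insert _ _) (Finset.subset_insert _ _)
    (by omega) h2 h3

/-- **A line through a point of `π₂ ∖ clF R₁` and a point of `π₃ ∖ clF R₁` has at most two points** (among the
points covered by the two planes). -/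
theorem card_le_two_of_rkN_le_two_of_cross (hs : ∀ e ∈ gr M, ∀ f ∈ gr M, e ≠ f → rkN M {e, f} = 2)
    {R₁ : Finset α} (hR₁g : R₁ ⊆ gr M) {c₂ c₃ : α} (hc₂g : c₂ ∈ gr M) (hc₃g : c₃ ∈ gr M)
    (hc₂ : c₂ ∉ clF M R₁) (hc₃ : c₃ ∉ clF M (insert c₂ R₁)) {S : Finset α} (hSg : S ⊆ gr M)
    (hS2 : rkN M S ≤ 2) (hcover : ∀ e ∈ S, e ∈ clF M (insert c₂ R₁) ∨ e ∈ clF M (insert c₃ R₁))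
    {y₂ y₃ : α} (hy₂ : y₂ ∈ S) (hy₂2 : y₂ ∈ clF M (insert c₂ R₁)) (hy₂R : y₂ ∉ clF M R₁)
    (hy₃ : y₃ ∈ S) (hy₃3 : y₃ ∈ clF M (insert c₃ R₁)) (hy₃R : y₃ ∉ clF M R₁) : S.card ≤ 2 := by
  by_contra h3
  rcases subset_plane_of_rkN_le_two_of_cover hs hSg hS2 (by omega) hcover with hS | hS
  · exact hy₃R (mem_clF_of_mem_two_planes hR₁g hc₂g hc₃g hc₂ hc₃ (hS hy₃) hy₃3)
  · exact hy₂R (mem_clF_of_mem_two_planes hR₁g hc₂g hc₃g hc₂ hc₃ hy₂2 (hS hy₂))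

/-- **Two lines of `clF B₀` through a common point `a` off the pencil point, both coplanar with the two off-points,
span a line**: both lie in the plane `clF {a, w₀, x}`, which meets `clF B₀` in rank `≤ 2`. -/
theorem rkN_union_le_two_of_coplanar_off (hG : G ∈ flatsQ M (5 + 1)) {B₀ : Finset α}
    (hB₀ : B₀ ∈ thinMembers M 5 G) {w₀ x : α} (hD : G \ clF M B₀ = {w₀, x}) {R R' : Finset α}
    (hRB : R ⊆ clF M B₀) (hR'B : R' ⊆ clF M B₀) (hRG : R ⊆ G) (hR'G : R' ⊆ G)
    (hRc : rkN M (insert w₀ (insert x R)) ≤ 3) (hR'c : rkN M (insert w₀ (insert x R')) ≤ 3) {a : α}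
    (haR : a ∈ R) (haR' : a ∈ R') (ha3 : rkN M {a, w₀, x} = 3) : rkN M (R ∪ R') ≤ 2 := by
  have hGg : G ⊆ gr M := (mem_flatsQ.1 hG).1
  have hw₀G : w₀ ∈ G := by
    have : w₀ ∈ G \ clF M B₀ := by rw [hD]; exact Finset.mem_insert_self _ _
    exact (Finset.mem_sdiff.1 this).1
  have hxG : x ∈ G := by
    have : x ∈ G \ clF M B₀ := by rw [hD]; exact Finset.mem_insert_of_mem (Finset.mem_singleton_self _)
    exact (Finset.mem_sdiff.1 this).1
  have hXg : ({a, w₀, x} : Finset α) ⊆ gr M := by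
    intro e he
    rw [Finset.mem_insert, Finset.mem_insert, Finset.mem_singleton] at he
    rcases he with rfl | rfl | rfl
    · exact hGg (hRG haR)
    · exact hGg hw₀G
    · exact hGg hxG
  have hB₀G : B₀ ⊆ G := subset_G_of_mem_thinMembers hB₀
  have hB₀g : B₀ ⊆ gr M := hB₀G.trans hGg
  -- a line coplanar with `w₀, x` through `a` lies in `clF {a, w₀, x}`
  have key : ∀ S : Finset α, S ⊆ G → a ∈ S → rkN M (insert w₀ (insert x S)) ≤ 3 → S ⊆ clF M {a, w₀, x} := by
    intro S hSG haS hSc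
    have hYg : insert w₀ (insert x S) ⊆ gr M :=
      Finset.insert_subset (hGg hw₀G) (Finset.insert_subset (hGg hxG) (hSG.trans hGg))
    have hXY : ({a, w₀, x} : Finset α) ⊆ clF M (insert w₀ (insert x S)) := by
      refine Finset.Subset.trans ?_ (subset_clF_of_subset_gr hYg)
      intro e he
      rw [Finset.mem_insert, Finset.mem_insert, Finset.mem_singleton] at he
      rw [Finset.mem_insert, Finset.mem_insert]
      rcases he with rfl | rfl | rfl
      · exact Or.inr (Or.inr haS)
      · exact Or.inl rfl
      · exact Or.inr (Or.inl rfl)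
    have heq := clF_eq_clF_of_subset_clF_of_rkN_le hYg hXY (by omega)
    intro e he
    rw [heq]
    exact subset_clF_of_subset_gr hYg (Finset.mem_insert_of_mem (Finset.mem_insert_of_mem he))
  have hsub : R ∪ R' ⊆ clF M {a, w₀, x} ∩ clF M B₀ := by
    intro e he
    rw [Finset.mem_union] at he
    rw [Finset.mem_inter]
    rcases he with he | he
    · exact ⟨key R hRG haR hRc he, hRB he⟩
    · exact ⟨key R' hR'G haR' hR'c he, hR'B he⟩
  have hmod := rkN_inter_clF_add_le hXg hB₀g
  have hB₀5 : rkN M B₀ = 5 := rkN_eq_five_of_mem_thinMembers hB₀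
  have hG6 : rkN M G = 5 + 1 := rkN_eq_of_mem_flatsQ hG
  have hGsub : G ⊆ clF M ({a, w₀, x} ∪ B₀) := by
    intro e he
    by_cases heB : e ∈ clF M B₀
    · exact clF_mono Finset.subset_union_right heB
    · have : e ∈ G \ clF M B₀ := Finset.mem_sdiff.2 ⟨he, heB⟩
      rw [hD, Finset.mem_insert, Finset.mem_singleton] at this
      refine subset_clF_of_subset_gr (Finset.union_subset hXg hB₀g) (Finset.mem_union_left _ ?_)
      rw [Finset.mem_insert, Finset.mem_insert, Finset.mem_singleton]
      rcases this with rfl | rfl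
      · exact Or.inr (Or.inl rfl)
      · exact Or.inr (Or.inr rfl)
  have h6 : 5 + 1 ≤ rkN M ({a, w₀, x} ∪ B₀) := by
    have := rkN_mono (M := M) hGsub
    rw [rkN_clF] at this
    omega
  have := rkN_mono (M := M) hsub
  omega

/-- **Two basis lines through a point `a` off the pencil point are not both coplanar with the off-points.** -/
theorem not_coplanar_off_of_coplanar_off (hG : G ∈ flatsQ M (5 + 1)) {B₀ : Finset α}
    (hB₀ : B₀ ∈ thinMembers M 5 G) {w₀ x : α} (hD : G \ clF M B₀ = {w₀, x}) {a b c : α}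
    (haB : a ∈ clF M B₀) (hbB : b ∈ clF M B₀) (hcB : c ∈ clF M B₀) (haG : a ∈ G) (hbG : b ∈ G) (hcG : c ∈ G)
    (h3 : rkN M {a, b, c} = 3) (ha3 : rkN M {a, w₀, x} = 3)
    (hab : rkN M (insert w₀ (insert x {a, b})) ≤ 3) : ¬ rkN M (insert w₀ (insert x {a, c})) ≤ 3 := by
  intro hac
  have hRB : ({a, b} : Finset α) ⊆ clF M B₀ := by
    intro e he
    rw [Finset.mem_insert, Finset.mem_singleton] at he
    rcases he with rfl | rfl
    · exact haB
    · exact hbB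
  have hR'B : ({a, c} : Finset α) ⊆ clF M B₀ := by
    intro e he
    rw [Finset.mem_insert, Finset.mem_singleton] at he
    rcases he with rfl | rfl
    · exact haB
    · exact hcB
  have hRG : ({a, b} : Finset α) ⊆ G := by
    intro e he
    rw [Finset.mem_insert, Finset.mem_singleton] at he
    rcases he with rfl | rfl
    · exact haG
    · exact hbG
  have hR'G : ({a, c} : Finset α) ⊆ G := by
    intro e he
    rw [Finset.mem_insert, Finset.mem_singleton] at he
    rcases he with rfl | rfl
    · exact haG
    · exact hcG
  have h := rkN_union_le_two_of_coplanar_off hG hB₀ hD hRB hR'B hRG hR'G hab hac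
    (Finset.mem_insert_self _ _) (Finset.mem_insert_self _ _) ha3
  have hU : ({a, b} : Finset α) ∪ {a, c} = {a, b, c} := by
    ext u
    simp only [Finset.mem_union, Finset.mem_insert, Finset.mem_singleton]
    tauto
  rw [hU] at h
  omega

/-- **The two-planes regime**: a lossy big pair `(B, z)` without good points yields a line `R₁ ⊆ (Q ∖ K) ∖ {w₀, x}`
(`Q = insert z B`) of rank `2` with `|R₁| + 3 = |Q ∖ K|` points coplanar with `w₀, x`, and two points `c₂, c₃` of `(Q ∖ K) ∖ {w₀, x}`
with `rk (R₁ ∪ {c₂, c₃}) = 4` such that every point of `(G ∖ K) ∖ {w₀, x}` lies in `clF (insert c₂ R₁)` or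
`clF (insert c₃ R₁)`. -/
theorem exists_two_planes_of_no_gtPts (hG : G ∈ flatsQ M (5 + 1)) (hd : (gr M \ G).card = 2)
    (hk : kColoops M G = 1) (hs : ∀ e ∈ gr M, ∀ f ∈ gr M, e ≠ f → rkN M {e, f} = 2)
    (hl : ∀ e ∈ gr M, M.Indep {e}) {B₀ : Finset α} (hB₀ : B₀ ∈ thinMembers M 5 G) {w₀ x : α}
    (hD : G \ clF M B₀ = {w₀, x}) {B : Finset α} (hB : B ∈ thinMembers M 5 G)
    (hbig : 5 ≤ (B \ coloops M G).card) {z : α} (hz : z ∈ G \ clF M B) (h : loss M 5 G B z ≠ 0)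
    (hno : ¬ (gtPts M 5 G (insert z B)).Nonempty) :
    ∃ R₁ ⊆ (insert z B \ coloops M G) \ {w₀, x}, rkN M R₁ = 2 ∧ 3 ≤ R₁.card ∧
      R₁.card + 3 = (insert z B \ coloops M G).card ∧ rkN M (insert w₀ (insert x R₁)) ≤ 3 ∧
      ∃ c₂ ∈ (insert z B \ coloops M G) \ {w₀, x}, ∃ c₃ ∈ (insert z B \ coloops M G) \ {w₀, x},
        c₂ ∉ clF M R₁ ∧ c₃ ∉ clF M (insert c₂ R₁) ∧
        ∀ e ∈ (G \ coloops M G) \ {w₀, x}, e ∈ clF M (insert c₂ R₁) ∨ e ∈ clF M (insert c₃ R₁) := by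
  obtain ⟨hR2, hRcard⟩ := rkN_sdiff_coloops_eq_two_of_loss_ne_zero hG hd hk hs hl hB hbig hz h
  have hcop := rkN_line_off_le_three_of_no_gtPts hG hd hk hs hl hB₀ hD hB hbig hz h hno
  obtain ⟨c₂, hc₂, c₃, hc₃, hne, hc₂off, hc₃off, hcover⟩ :=
    two_planes_of_no_gtPts hG hd hk hs hl hB₀ hD hB hbig hz h hno
  obtain ⟨R, hRdef⟩ : ∃ R : Finset α,
      R = (insert z B \ coloops M G) \ coloops M (insert z B \ coloops M G) := ⟨_, rfl⟩
  rw [← hRdef] at hR2 hRcard hcop hcover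
  have hGg : G ⊆ gr M := (mem_flatsQ.1 hG).1
  have hd' : (gr M \ G).card ≤ 5 := by omega
  have hQG : insert z B ⊆ G :=
    Finset.insert_subset (Finset.mem_sdiff.1 hz).1 (subset_G_of_mem_thinMembers hB)
  have hKB : coloops M G ⊆ B := coloops_subset_of_mem_thinMembers hG hd' hB
  have hKQ : coloops M G ⊆ insert z B := hKB.trans (Finset.subset_insert _ _)
  have hzB : z ∉ B := fun h' => (Finset.mem_sdiff.1 hz).2 (subset_clF_of_subset_gr
    ((subset_G_of_mem_thinMembers hB).trans hGg) h')
  have hzK : z ∉ coloops M G := fun h' => hzB (hKB h')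
  have hQ'6 : 6 ≤ (insert z B \ coloops M G).card := by
    have heq : insert z B \ coloops M G = insert z (B \ coloops M G) := by
      ext e
      simp only [Finset.mem_sdiff, Finset.mem_insert]
      constructor
      · rintro ⟨h' | h', h2⟩
        · exact Or.inl h'
        · exact Or.inr ⟨h', h2⟩
      · rintro (rfl | ⟨h', h2⟩)
        · exact ⟨Or.inl rfl, hzK⟩
        · exact ⟨Or.inr h', h2⟩
    rw [heq, Finset.card_insert_of_notMem (fun h' => hzB (Finset.mem_sdiff.1 h').1)]
    omega
  have hR3 : 3 ≤ R.card := by omega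
  have hRQ' : R ⊆ insert z B \ coloops M G := by
    rw [hRdef]
    exact Finset.sdiff_subset
  have hRG : R ⊆ G := hRQ'.trans (Finset.sdiff_subset.trans hQG)
  have hoff := notMem_or_notMem_insert_of_loss_ne_zero hG hd hk hs hl hB₀ hD hB hbig hz h
  have hRoff : ∀ u v : α, ({w₀, x} : Finset α) = {u, v} → u ∉ insert z B → u ∉ R ∧ v ∉ R := by
    intro u v huv huQ
    have huR : u ∉ R := fun h' => huQ (Finset.mem_sdiff.1 (hRQ' h')).1
    exact ⟨huR, notMem_of_rkN_le_two_of_notMem hs hG hD hRG (by omega) hR3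
      (by rw [huv]; exact Finset.pair_comm _ _) huR⟩
  have hw₀x : w₀ ∉ R ∧ x ∉ R := by
    rcases hoff with h' | h'
    · exact hRoff w₀ x rfl h'
    · exact (hRoff x w₀ (Finset.pair_comm _ _) h').symm
  have hRV : R ⊆ (insert z B \ coloops M G) \ {w₀, x} := by
    intro r hr
    rw [Finset.mem_sdiff, Finset.mem_insert, Finset.mem_singleton]
    refine ⟨hRQ' hr, ?_⟩
    rintro (rfl | rfl)
    · exact hw₀x.1 hr
    · exact hw₀x.2 hr
  -- the coloops `c₂`, `c₃` of `Q'` are off the line and off each other's plane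
  have hcol : ∀ c ∈ coloops M (insert z B \ coloops M G), c ∉ clF M ((insert z B).erase c) :=
    fun c hc => coloop_notMem_clF_erase hG hk hQG hKQ hc
  have hc₂V : c₂ ∈ (insert z B \ coloops M G) \ {w₀, x} := Finset.mem_sdiff.2 ⟨(mem_coloops.1 hc₂).1, hc₂off⟩
  have hc₃V : c₃ ∈ (insert z B \ coloops M G) \ {w₀, x} := Finset.mem_sdiff.2 ⟨(mem_coloops.1 hc₃).1, hc₃off⟩
  have hRerase : ∀ c ∈ coloops M (insert z B \ coloops M G), R ⊆ (insert z B).erase c := by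
    intro c hc r hr
    refine Finset.mem_erase.2 ⟨?_, (Finset.mem_sdiff.1 (hRQ' hr)).1⟩
    intro hrc
    rw [hrc] at hr
    rw [hRdef, Finset.mem_sdiff] at hr
    exact hr.2 hc
  have hc₂R : c₂ ∉ clF M R := fun h' => hcol c₂ hc₂ (clF_mono (hRerase c₂ hc₂) h')
  have hc₃R : c₃ ∉ clF M (insert c₂ R) := by
    intro h'
    apply hcol c₃ hc₃
    refine clF_mono ?_ h'
    refine Finset.insert_subset ?_ (hRerase c₃ hc₃)
    exact Finset.mem_erase.2 ⟨hne, (Finset.mem_sdiff.1 (mem_coloops.1 hc₂).1).1⟩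
  refine ⟨R, hRV, hR2, hR3, hRcard, hcop, c₂, hc₂V, c₃, hc₃V, hc₂R, hc₃R, ?_⟩
  intro e he
  rw [Finset.mem_sdiff] at he
  exact hcover e he.1 he.2

end PercRepro.Shadow
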